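import Summits.QuantumFields.YangMills.Theorems.AlphaInputsT3ACv3RegionAxialGauge
import Summits.QuantumFields.YangMills.Theorems.AlphaInputsT3ACv3ModelBox
import HarnessLib

/-!
# `AlphaInputsT3ACv3StencilGauge` — (r1-σ), the ASSEMBLY (σ-B): **ONE COMB GAUGE FLATTENS A WHOLE STENCIL REGION THAT IS A UNION OF ANCHORED BOXES** — for ANY field `W` on `T^{(j)}`, base
# `y`, and integer side data `T : Fin m → Fin d → ℤ` (the region `D = ⋃_i [y, y + T_i]`, e.g. a box, a box minus an upper quarter-column `{x₁ ≤ a} ∪ {x₂ ≤ b}`, a box minus an upper octant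
# `{x₁ ≤ a} ∪ {x₂ ≤ b} ∪ {x₃ ≤ c}` — the three shapes `(3^d-stencil of c) ∩ Ω_fine` takes near a face ∕ an inward edge ∕ an inward vertex of `Ω`): if the plaquettes of `W` inside `D` are within
# `δ` of `1`, the axially gauged field `W^{v₀}`, `v₀ = axialT W y`, has `dist1(W^{v₀}_b) ≤ |x − y|₁·δ ≤ (Σ_κ T_i κ)·δ` at EVERY bond `b = ⟨x, μ⟩` of `D` (`x ≥ y`, `x + e_μ ∈ [y, y + T_i]`) —
# one gauge for the whole stencil, `k`-uniform, no interpolation, no gluing — cell `ym3-torus`, width seat `ym-ust-19936-w2` (g2), for ★w1-19936 g2 LEAD's row (r1-σ) and ★w4-19936 g2's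
# framed linearisation (B) («σ on N ∩ Ω_fine with ‖U^σ(b) − 1‖ ≤ η′»)

WHY (★w1-19936 g2 LEAD 02:22:38Z (r1-route)∕(r1-σ): frames `ψ(b,c) := Ad(σ_c(b₋)⁻¹σ_c(ĉ₋))` from ANY fine gauge `σ_c` that is `η′`-flat on `(stencil of c) ∩ Ω_fine`; LOCATED L-3: nothing may be
reconciled across stencils, and nothing needs to be — the frame is relative INSIDE one gauge).  ★w1 g0's `RegionAxialGauge.dist1_gaugeActT_axialT_le_of_box` flattens one bond from the
plaquettes of a PRODUCT SET containing the coordinate box spanned by `y` and `x + e_μ`.  The stencil regions are not product sets, but each is a union of ≤ 3 product boxes ANCHORED AT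
THE SAME LOW CORNER `y` (orient `y` opposite the removed column∕octant); a bond of `D` whose far endpoint lies in the anchored box `[y, y + T_i]` has its whole coordinate box in
`[y, y + T_i]` (anchored boxes are down-closed) — so the SAME comb gauge `axialT W y` serves every bond of `D`, each through its own sub-box.  That is all this file does.
WHAT.  §1 `dist1_gaugeActT_axialT_le_of_anchored` (abstract product set `S = Π I κ` containing the anchored integer box `[0, (x − y) + e_μ]` around `y`); §2 ★★ `dist1_gaugeActT_axialT_le_of_boxes`
(integer side data `T`, plaquette hypothesis on the plaquettes inside some `[y, y + T_i]` in RELATIVE COORDINATES `rel y ·`, conclusion for every bond with `x − y ≥ 0`, `x − y + e_μ ≤ T_i`;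
no-wrap margin `2T_i κ + 4 ≤ sitesPerDir`), `…_le_sum` (`≤ (Σ_κ T_i κ)·δ`); §3 the `SU(n)` operator-norm ∕ `GaugeField.gaugeAct` spelling ★ `norm_gaugeAct_axialT_sub_one_le_of_boxes` — exactly the
consumer shape of ★w4 g2's (B) `…NewtonLiftFramedLinearisation` (`σ := axialT U y`, `η′ := (Σ_κ T_i κ)·δ`); §4 the same in the LEAD's CHART `ModelBox.boxSite y u = y + u` (integer coordinates in,
integer coordinates out: plaquettes `⟨y + w; α, β⟩` with `0 ≤ w`, `w + e_α + e_β ≤ T_i`; bonds `⟨y + u, μ⟩` with `0 ≤ u`, `u + e_μ ≤ T_i`) ★★ `norm_gaugeAct_axialT_boxSite_sub_one_le`.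
HONEST FRAMING.  A cover argument over ★w1 g0's regional axial gauge (cited, not restated); no smallness, every `δ ≥ 0`, any `GaugeGroup`.  Count-neutral helper toward the (FL) row of 2′∕2′χ
(`--supports stmt-QuantumFields-19936`); (FL)∕`hLift`, the stub, the crux and the gap are NOT claimed; registry untouched.  YM₃ on the three-torus is RUNG R3 of the programme, not the
Clay problem.

References: T. Bałaban, Commun. Math. Phys. 98 (1985) 17–51 [Balaban1985Averaging] ((8)–(9) p.18, (19)–(20) p.21, pp.24–25); Commun. Math. Phys. 99 (1985) 75–102 [Balaban1985RegularSpaces]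
(Lemma 1 (1.24)–(1.25) p.79).
-/

set_option autoImplicit false

noncomputable section

open scoped Matrix.Norms.L2Operator

namespace Summit.QuantumFields.YangMills.Theorems.StencilGauge

open Literature.MathematicalPhysics.QuantumFieldTheory.Balaban1983to89
open B10Eq27TorusAxialLog (axialT gaugeActT rel transl transl_apply transl_add_e rel_transl_of_mem)
open B7Prop1Explicit (l1 e e_apply)
open Summit.QuantumFields.YangMills.Theorems.RegionAxialGauge (dist1_gaugeActT_axialT_le_of_box)

variable {P : Params} {j : ℕ} {G : Type*} [GaugeGroup G]

/-! ## §1 One bond through an anchored box inside a product set -/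

/-- **ONE BOND THROUGH THE ANCHORED BOX**: if `x − y ≥ 0` coordinatewise and the product set `S = Π_κ I κ` contains the anchored integer box `{y + t : 0 ≤ t ≤ (x − y) + e_μ}`, and the
plaquettes of `W` with extreme corners in `S` are within `δ ≥ 0` of `1`, then `dist1(W^{axialT W y}⟨x, μ⟩) ≤ |x − y|₁·δ` (★w1 g0's `dist1_gaugeActT_axialT_le_of_box`, its coordinate box being
`[0, (x − y) + e_μ]` when `x − y ≥ 0`). [cite: Balaban1985Averaging, pp.24-25; Balaban1985RegularSpaces, Lemma 1 p.79] -/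
theorem dist1_gaugeActT_axialT_le_of_anchored (W : GaugeField P j G) {I : Fin P.d → Set (ZMod (P.sitesPerDir j))} {δ : ℝ} (hδ : 0 ≤ δ)
    (hW : ∀ q : Plaq P j, q.src ∈ {z : Site P j | ∀ κ, z κ ∈ I κ} →
      (q.src.shift q.μ).shift q.ν ∈ {z : Site P j | ∀ κ, z κ ∈ I κ} → dist1 (GaugeField.plaqHol W q) ≤ δ)
    (y x : Site P j) (μ : Fin P.d) (hwrap : (rel y x μ + 1) * 2 ≤ (P.sitesPerDir j : ℤ)) (hv : ∀ κ, 0 ≤ rel y x κ)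
    (hI : ∀ (κ : Fin P.d) (t : ℤ), 0 ≤ t → t ≤ (rel y x + e μ) κ → y κ + ((t : ℤ) : ZMod (P.sitesPerDir j)) ∈ I κ) :
    dist1 (gaugeActT (axialT W y) W ⟨x, μ⟩) ≤ (l1 (rel y x) : ℝ) * δ := by
  refine dist1_gaugeActT_axialT_le_of_box W hδ hW y x μ hwrap (fun κ t ht1 ht2 => ?_)
  have ha : 0 ≤ rel y x κ := hv κ
  have hab : rel y x κ ≤ (rel y x + e μ) κ := by
    rw [Pi.add_apply, e_apply]; split_ifs <;> omega
  rw [min_eq_left (le_min ha (ha.trans hab))] at ht1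
  rw [max_eq_right hab, max_eq_right (ha.trans hab)] at ht2
  exact hI κ t ht1 ht2

/-! ## §2 The stencil region as a union of anchored boxes with integer side data -/

/-- Two integers in `[0, N)` with equal residues are equal. [folklore] -/
theorem int_eq_of_cast_eq {N : ℕ} {a b : ℤ} (ha0 : 0 ≤ a) (haN : a < N) (hb0 : 0 ≤ b) (hbN : b < N) (h : ((a : ℤ) : ZMod N) = ((b : ℤ) : ZMod N)) : a = b := by
  have hdvd : (N : ℤ) ∣ b - a := (ZMod.intCast_eq_intCast_iff_dvd_sub a b N).mp h
  have hz : b - a = 0 := Int.eq_zero_of_dvd_of_natAbs_lt_natAbs hdvd (by omega)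
  omega

/-- **★★ THE STENCIL GAUGE**: base `y`, side data `T : Fin m → Fin d → ℤ` (`T ≥ 0`, no-wrap margin `2·T_i κ + 4 ≤ sitesPerDir`); if every plaquette whose lower corner `z` has `0 ≤ z − y` and
`(z − y) + e_μ + e_ν ≤ T_i` for SOME `i` (i.e. every plaquette inside the region `D = ⋃_i [y, y + T_i]`) is within `δ ≥ 0` of `1`, then for every bond `⟨x, μ⟩` with `x − y ≥ 0` and
`(x − y) + e_μ ≤ T_i` for some `i`: `dist1(W^{axialT W y}⟨x, μ⟩) ≤ |x − y|₁·δ` — ONE comb gauge for all of `D`. [cite: Balaban1985Averaging, pp.24-25; Balaban1985RegularSpaces, Lemma 1 p.79] -/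
theorem dist1_gaugeActT_axialT_le_of_boxes (W : GaugeField P j G) {δ : ℝ} (hδ : 0 ≤ δ) (y : Site P j) {m : ℕ} (T : Fin m → Fin P.d → ℤ)
    (hT0 : ∀ i κ, 0 ≤ T i κ) (hTN : ∀ i κ, 2 * T i κ + 4 ≤ (P.sitesPerDir j : ℤ))
    (hW : ∀ q : Plaq P j, (∃ i, ∀ κ, 0 ≤ rel y q.src κ ∧ (rel y q.src + e q.μ + e q.ν) κ ≤ T i κ) → dist1 (GaugeField.plaqHol W q) ≤ δ)
    (x : Site P j) (μ : Fin P.d) (hv : ∀ κ, 0 ≤ rel y x κ) (i : Fin m) (hx : ∀ κ, (rel y x + e μ) κ ≤ T i κ) :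
    dist1 (gaugeActT (axialT W y) W ⟨x, μ⟩) ≤ (l1 (rel y x) : ℝ) * δ := by
  -- the anchored box `[y, y + T_i]` as a product set
  let I : Fin P.d → Set (ZMod (P.sitesPerDir j)) := fun κ => {z | ∃ t : ℤ, 0 ≤ t ∧ t ≤ T i κ ∧ z = y κ + ((t : ℤ) : ZMod (P.sitesPerDir j))}
  have hwrap : (rel y x μ + 1) * 2 ≤ (P.sitesPerDir j : ℤ) := by
    have h := hx μ
    rw [Pi.add_apply, e_apply, if_pos rfl] at h
    linarith [hTN i μ]
  refine dist1_gaugeActT_axialT_le_of_anchored W (I := I) hδ (fun q h1 h2 => ?_) y x μ hwrap hv (fun κ t ht0 ht1 => ⟨t, ht0, ht1.trans (hx κ), rfl⟩)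
  -- a plaquette with both extreme corners in the anchored box is inside `[y, y + T_i]` in relative coordinates
  choose t ht using h1
  choose s hs using h2
  have hsrc : q.src = transl y t := funext fun κ => by rw [transl_apply]; exact (ht κ).2.2
  have hfar : (q.src.shift q.μ).shift q.ν = transl y (t + e q.μ + e q.ν) := by rw [transl_add_e, transl_add_e, hsrc]
  have hrel : rel y q.src = t := by
    rw [hsrc]
    refine rel_transl_of_mem y t (fun κ => ⟨?_, ?_⟩)
    · have := (ht κ).1; have := hTN i κ; have := hT0 i κ; omega
    · have := (ht κ).2.1; have := hTN i κ; omega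
  have hts : ∀ κ, (t + e q.μ + e q.ν) κ = s κ := by
    intro κ
    have hk := (hs κ).2.2
    rw [hfar, transl_apply] at hk
    have hk' := add_left_cancel hk
    have he : (t + e q.μ + e q.ν) κ ≤ t κ + 2 ∧ t κ ≤ (t + e q.μ + e q.ν) κ := by
      simp only [Pi.add_apply, e_apply]; split_ifs <;> omega
    have := (ht κ).1; have := (ht κ).2.1; have := (hs κ).1; have := (hs κ).2.1; have := hTN i κ
    exact int_eq_of_cast_eq (N := P.sitesPerDir j) (by omega) (by omega) (by omega) (by omega) hk'
  refine hW q ⟨i, fun κ => ⟨?_, ?_⟩⟩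
  · rw [hrel]; exact (ht κ).1
  · rw [hrel, hts κ]; exact (hs κ).2.1

/-- `|x − y|₁ ≤ Σ_κ T_i κ` for a bond of the sub-box `i` (`0 ≤ x − y`, `(x − y) + e_μ ≤ T_i`). [folklore] -/
theorem l1_rel_le_sum (y x : Site P j) (μ : Fin P.d) {m : ℕ} (T : Fin m → Fin P.d → ℤ) (hv : ∀ κ, 0 ≤ rel y x κ) (i : Fin m) (hx : ∀ κ, (rel y x + e μ) κ ≤ T i κ) :
    (l1 (rel y x) : ℝ) ≤ ∑ κ, (T i κ : ℝ) := by
  unfold l1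
  push_cast
  refine Finset.sum_le_sum (fun κ _ => ?_)
  have h1 : (((rel y x κ).natAbs : ℕ) : ℝ) = ((rel y x κ : ℤ) : ℝ) := by
    rw [← Int.cast_natCast, Int.natAbs_of_nonneg (hv κ)]
  have h2 : rel y x κ ≤ T i κ := by
    have h := hx κ
    rw [Pi.add_apply, e_apply] at h
    split_ifs at h <;> omega
  rw [h1]; exact_mod_cast h2

/-- **THE STENCIL GAUGE WITH THE SIDE SUM**: as `dist1_gaugeActT_axialT_le_of_boxes`, concluded as `≤ (Σ_κ T_i κ)·δ`. [cite: Balaban1985Averaging, pp.24-25; Balaban1985RegularSpaces, Lemma 1 p.79] -/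
theorem dist1_gaugeActT_axialT_le_sum_of_boxes (W : GaugeField P j G) {δ : ℝ} (hδ : 0 ≤ δ) (y : Site P j) {m : ℕ} (T : Fin m → Fin P.d → ℤ)
    (hT0 : ∀ i κ, 0 ≤ T i κ) (hTN : ∀ i κ, 2 * T i κ + 4 ≤ (P.sitesPerDir j : ℤ))
    (hW : ∀ q : Plaq P j, (∃ i, ∀ κ, 0 ≤ rel y q.src κ ∧ (rel y q.src + e q.μ + e q.ν) κ ≤ T i κ) → dist1 (GaugeField.plaqHol W q) ≤ δ)
    (x : Site P j) (μ : Fin P.d) (hv : ∀ κ, 0 ≤ rel y x κ) (i : Fin m) (hx : ∀ κ, (rel y x + e μ) κ ≤ T i κ) :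
    dist1 (gaugeActT (axialT W y) W ⟨x, μ⟩) ≤ (∑ κ, (T i κ : ℝ)) * δ :=
  (dist1_gaugeActT_axialT_le_of_boxes W hδ y T hT0 hTN hW x μ hv i hx).trans (mul_le_mul_of_nonneg_right (l1_rel_le_sum y x μ T hv i hx) hδ)

/-! ## §3 The `SU(n)` operator-norm reading in the `GaugeField.gaugeAct` spelling -/

section SU

variable {n : Type*} [Fintype n] [DecidableEq n] [Nonempty n]

/-- **★ THE STENCIL GAUGE FOR `SU(n)`, CONSUMER SPELLING**: with `σ := axialT U y` (the comb holonomies from the low corner `y` of the stencil), every bond `⟨x, μ⟩` of the region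
`D = ⋃_i [y, y + T_i]` has `‖(U^σ)(⟨x, μ⟩) − 1‖ ≤ (Σ_κ T_i κ)·δ` in operator norm, from `dist1 ≤ δ` on the plaquettes inside `D` alone (`GaugeField.gaugeAct`, `dist1 = ‖· − 1‖_op` by `rfl`).
[cite: Balaban1985Averaging, (8) p.18, pp.24-25; Balaban1985RegularSpaces, Lemma 1 (1.25) p.79] -/
theorem norm_gaugeAct_axialT_sub_one_le_of_boxes (U : GaugeField P j (Matrix.specialUnitaryGroup n ℂ)) {δ : ℝ} (hδ : 0 ≤ δ) (y : Site P j) {m : ℕ} (T : Fin m → Fin P.d → ℤ)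
    (hT0 : ∀ i κ, 0 ≤ T i κ) (hTN : ∀ i κ, 2 * T i κ + 4 ≤ (P.sitesPerDir j : ℤ))
    (hU : ∀ q : Plaq P j, (∃ i, ∀ κ, 0 ≤ rel y q.src κ ∧ (rel y q.src + e q.μ + e q.ν) κ ≤ T i κ) → dist1 (GaugeField.plaqHol U q) ≤ δ)
    (x : Site P j) (μ : Fin P.d) (hv : ∀ κ, 0 ≤ rel y x κ) (i : Fin m) (hx : ∀ κ, (rel y x + e μ) κ ≤ T i κ) :
    ‖((GaugeField.gaugeAct (axialT U y) U ⟨x, μ⟩ : Matrix.specialUnitaryGroup n ℂ) : Matrix n n ℂ) - 1‖ ≤ (∑ κ, (T i κ : ℝ)) * δ := by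
  have h := dist1_gaugeActT_axialT_le_sum_of_boxes U hδ y T hT0 hTN hU x μ hv i hx
  exact h

end SU

/-! ## §4 In the LEAD's chart `boxSite y u = y + u`: integer coordinates in, integer coordinates out -/

section Chart

open Summit.QuantumFields.YangMills.Theorems.ModelBox (boxSite)

/-- The chart of `…ModelBox` IS the translation of `B10Eq27TorusAxialLog` (`boxSite y u = transl y u`, by `rfl`). [folklore] -/
theorem boxSite_eq_transl (y : Site P j) (u : Fin P.d → ℤ) : boxSite y u = transl y u := rfl

/-- Inside the no-wrap window the relative position of `y + u` is `u`. [folklore] -/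
theorem rel_boxSite (y : Site P j) (u : Fin P.d → ℤ) (hu : ∀ κ, -(P.sitesPerDir j : ℤ) < 2 * u κ ∧ 2 * u κ ≤ (P.sitesPerDir j : ℤ)) : rel y (boxSite y u) = u := by
  rw [boxSite_eq_transl]
  exact rel_transl_of_mem y u (fun κ => ⟨by linarith [(hu κ).1], by linarith [(hu κ).2]⟩)

/-- **★★ THE STENCIL GAUGE IN THE CHART** (any `GaugeGroup`): base `y`, side data `T` (`T ≥ 0`, `2·T_i κ + 4 ≤ sitesPerDir`); plaquettes `⟨y + w; α, β⟩` with `0 ≤ w` and `w + e_α + e_β ≤ T_i` for some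
`i` within `δ ≥ 0` of `1` ⟹ every bond `⟨y + u, μ⟩` with `0 ≤ u`, `u + e_μ ≤ T_i` has `dist1((W^{axialT W y})⟨y + u, μ⟩) ≤ (Σ_κ T_i κ)·δ` (`GaugeField.gaugeAct` spelling; `ModelBox.e`).
[cite: Balaban1985Averaging, (8) p.18, pp.24-25; Balaban1985RegularSpaces, Lemma 1 (1.25) p.79] -/
theorem dist1_gaugeAct_axialT_boxSite_le_of_boxes (W : GaugeField P j G) {δ : ℝ} (hδ : 0 ≤ δ) (y : Site P j) {m : ℕ} (T : Fin m → Fin P.d → ℤ)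
    (hT0 : ∀ i κ, 0 ≤ T i κ) (hTN : ∀ i κ, 2 * T i κ + 4 ≤ (P.sitesPerDir j : ℤ))
    (hW : ∀ (w : Fin P.d → ℤ) (α β : Fin P.d) (hαβ : α < β), (∃ i, ∀ κ, 0 ≤ w κ ∧ (w + ModelBox.e α + ModelBox.e β) κ ≤ T i κ) →
      dist1 (GaugeField.plaqHol W ⟨boxSite y w, α, β, hαβ⟩) ≤ δ)
    (u : Fin P.d → ℤ) (μ : Fin P.d) (hu : ∀ κ, 0 ≤ u κ) (i : Fin m) (huT : ∀ κ, (u + ModelBox.e μ) κ ≤ T i κ) :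
    dist1 (GaugeField.gaugeAct (axialT W y) W ⟨boxSite y u, μ⟩) ≤ (∑ κ, (T i κ : ℝ)) * δ := by
  have huT' : ∀ κ, u κ ≤ T i κ := fun κ => by
    have h := huT κ
    rw [Pi.add_apply, ModelBox.e, Pi.single_apply] at h
    split_ifs at h <;> omega
  have hrel : rel y (boxSite y u) = u :=
    rel_boxSite y u (fun κ => ⟨by linarith [hu κ, hTN i κ, hT0 i κ], by linarith [huT' κ, hTN i κ]⟩)
  have h := dist1_gaugeActT_axialT_le_sum_of_boxes W hδ y T hT0 hTN (fun q hq => ?_) (boxSite y u) μ (fun κ => by rw [hrel]; exact hu κ) i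
    (fun κ => by rw [hrel]; exact huT κ)
  · exact h
  · obtain ⟨i', hq⟩ := hq
    have hsrc : boxSite y (rel y q.src) = q.src := by rw [boxSite_eq_transl, B10Eq27TorusAxialLog.transl_rel]
    have hq' := hW (rel y q.src) q.μ q.ν q.hμν ⟨i', hq⟩
    rwa [hsrc] at hq'

variable {n : Type*} [Fintype n] [DecidableEq n] [Nonempty n]

/-- **★★ THE STENCIL GAUGE IN THE CHART, `SU(n)` OPERATOR NORM**: `‖(U^{axialT U y})⟨y + u, μ⟩ − 1‖ ≤ (Σ_κ T_i κ)·δ` for every bond of `D = ⋃_i [y, y + T_i]`, from `dist1 ≤ δ` on the plaquettes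
inside `D` — the input «`σ_c` on `(stencil of c) ∩ Ω_fine` with `‖U^{σ_c} − 1‖ ≤ η′`» of the (r1) frames, with `σ_c := axialT U y_c`, `y_c` the low corner of the stencil oriented away from the
removed column∕octant. [cite: Balaban1985Averaging, (8) p.18, pp.24-25; Balaban1985RegularSpaces, Lemma 1 (1.25) p.79] -/
theorem norm_gaugeAct_axialT_boxSite_sub_one_le (U : GaugeField P j (Matrix.specialUnitaryGroup n ℂ)) {δ : ℝ} (hδ : 0 ≤ δ) (y : Site P j) {m : ℕ}
    (T : Fin m → Fin P.d → ℤ) (hT0 : ∀ i κ, 0 ≤ T i κ) (hTN : ∀ i κ, 2 * T i κ + 4 ≤ (P.sitesPerDir j : ℤ))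
    (hU : ∀ (w : Fin P.d → ℤ) (α β : Fin P.d) (hαβ : α < β), (∃ i, ∀ κ, 0 ≤ w κ ∧ (w + ModelBox.e α + ModelBox.e β) κ ≤ T i κ) →
      dist1 (GaugeField.plaqHol U ⟨boxSite y w, α, β, hαβ⟩) ≤ δ)
    (u : Fin P.d → ℤ) (μ : Fin P.d) (hu : ∀ κ, 0 ≤ u κ) (i : Fin m) (huT : ∀ κ, (u + ModelBox.e μ) κ ≤ T i κ) :
    ‖((GaugeField.gaugeAct (axialT U y) U ⟨boxSite y u, μ⟩ : Matrix.specialUnitaryGroup n ℂ) : Matrix n n ℂ) - 1‖ ≤ (∑ κ, (T i κ : ℝ)) * δ :=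
  dist1_gaugeAct_axialT_boxSite_le_of_boxes U hδ y T hT0 hTN hU u μ hu i huT

end Chart

end Summit.QuantumFields.YangMills.Theorems.StencilGauge

end
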